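import Summits.Ventures.GridStability.Lyapunov.StructurePreservingSwitchKit
import HarnessLib

/-!
# GridStability/Lyapunov/StructurePreservingSwitchExist — switching certificate, file 2: connectivity
# and coercivity from the supersolution, the uniform polytope level, and EXISTENCE of the post-switch
# synchronous equilibrium with the injections kept

Cell `gridfusion` (LADDER-GRIDFUSION), seat gridfusion-lyap-1 (g9), line «G2.b-NE39SP-N1-SWITCH»; file 1
is `StructurePreservingSwitchKit.lean` (certificate format `Switch.Cert`, the decidable `Cert.check`,
cast lemmas). MODEL MV-3 on an indexed edge list (model-2's `StructurePreserving.Params`,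
`symmetrize (edgeWeight src tgt w)`, half-angle equilibria).

WHAT IS HERE: rotation lemmas (`potential_add_const`, `energy_add_const`,
`isSyncEquilibrium_add_const`, `shifted_eq_self_of_sum_P0`); **`preconnected_of_coercive`** (a grounded coercivity inequality forces the coupling
graph to be connected — no spanning-tree table needed); **`coercive_of_lapQ`** (coercivity from the
supersolution conjunct, through lit-1's `ClassicalModel.coercive_of_supersolution`
[cite: BermanPlemmons1994, Ch. 6 Thm 2.3 (I27)–(I28)]); `vtGap_ge_uniform` / `levelFactor_le_vtGap`
(`2cos γ − π sin γ ≤ vtGap s` on `|s| ≤ γ ≤ π/2`, so the check's level conjunct gives the per-edge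
polytope level of [cite: VuTuritsyn2016, Appendix 9.3]); and **`exists_equilibrium_of_check`**: the
post-switch model with the KEPT injections `P⁰ = f⁰(halfAngle t0)` has a synchronous angle vector
`θ¹`, `θ¹_r = θ̃_r`, `|θ¹ᵢ − θ̃ᵢ| < R`, all `n` power-flow equations exactly, every coupled branch inside
`γ = 2·arctan τγ < π/2` — lit-1's `ClassicalModel.exists_equilibrium_of_residual_reference`
[cite: DvijothamLowChertkov2015, §3.3 Corollary 1; BoydVandenberghe2004, §9.1.2 eq. (9.11)].
THREE COLUMNS: mathematics about MODEL MV-3 (soundness of a certificate format); no sentence here says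
any grid is stable. No definition; no named fact; standard axioms.
-/

noncomputable section

open Set Filter Topology Real Finset
open Summit.Ventures.GridStability.Models.StructurePreserving
open Summit.Ventures.GridStability.Models.StructurePreserving.Params
open Literature.MathematicalPhysics.PowerSystems

namespace Summit.Ventures.GridStability.Lyapunov.StructurePreserving.Switch

variable {n m : ℕ}

/-! ### Connectivity and coercivity from the supersolution -/

/-- **A grounded coercivity inequality forces connectivity.** If `bᵢⱼ = bⱼᵢ` and for some `μ > 0`,
`c₀`, every node vector `v` vanishing at `r` satisfies `μΣvᵢ² ≤ c₀·½ΣΣ bᵢⱼ(vᵢ − vⱼ)²`, then the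
coupling graph is preconnected (test `v` = indicator of the nodes NOT reachable from `r`: the
Dirichlet form vanishes, so `v ≡ 0`). No spanning-tree witness is needed. [folklore] -/
theorem preconnected_of_coercive (p : Params n) (hbs : ∀ i j, p.b i j = p.b j i) (r : Fin n)
    {μ c₀ : ℝ} (hμ : 0 < μ)
    (hcoer : ∀ v : Fin n → ℝ, v r = 0 →
      μ * ∑ i, v i ^ 2 ≤ c₀ * (1 / 2 * ∑ i, ∑ j, p.b i j * (v i - v j) ^ 2)) :
    p.couplingGraph.Preconnected := by
  classical
  set v : Fin n → ℝ := fun i => if p.couplingGraph.Reachable r i then 0 else 1 with hv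
  have hvr : v r = 0 := by simp [hv]
  have hform : ∑ i, ∑ j, p.b i j * (v i - v j) ^ 2 = 0 := by
    refine Finset.sum_eq_zero fun i _ => Finset.sum_eq_zero fun j _ => ?_
    by_cases hb : p.b i j = 0
    · simp [hb]
    · by_cases hij : i = j
      · subst hij; simp
      · have hadj : p.couplingGraph.Adj i j := (p.couplingGraph_adj_of_symm hbs i j).mpr ⟨hij, hb⟩
        have hiff : p.couplingGraph.Reachable r i ↔ p.couplingGraph.Reachable r j :=
          ⟨fun h => h.trans hadj.reachable, fun h => h.trans hadj.symm.reachable⟩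
        have : v i = v j := by
          simp only [hv]
          by_cases hri : p.couplingGraph.Reachable r i
          · simp [hri, hiff.mp hri]
          · simp [hri, mt hiff.mpr hri]
        simp [this]
  have hle := hcoer v hvr
  rw [hform] at hle
  have hsum0 : ∑ i, v i ^ 2 ≤ 0 := by
    have : μ * ∑ i, v i ^ 2 ≤ μ * 0 := by simpa using hle
    exact le_of_mul_le_mul_left this hμ
  have hall : ∀ i, v i = 0 := by
    intro i
    have h0 : ∑ j, v j ^ 2 = 0 :=
      le_antisymm hsum0 (Finset.sum_nonneg fun j _ => sq_nonneg (v j))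
    have := (Finset.sum_eq_zero_iff_of_nonneg fun j _ => sq_nonneg (v j)).mp h0 i (mem_univ i)
    exact pow_eq_zero_iff (n := 2) (by norm_num) |>.mp this
  have hreach : ∀ i, p.couplingGraph.Reachable r i := by
    intro i
    by_contra h
    have : v i = 1 := by simp [hv, h]
    rw [hall i] at this
    exact zero_ne_one this
  intro u w
  exact (hreach u).symm.trans (hreach w)

/-- **Coercivity from the supersolution conjunct** (Collatz–Barta / Berman–Plemmons through lit-1's
`ClassicalModel.coercive_of_supersolution`): for couplings from an edge list with `w ≥ 0` and no
self-loop, a vector `x > 0` with `μxᵢ ≤ c₀·(L x)ᵢ` at every `i ≠ r` (`c₀ ≥ 0`) gives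
`μΣvᵢ² ≤ c₀·½ΣΣ bᵢⱼ(vᵢ − vⱼ)²` for every `v` with `v_r = 0`.
[cite: BermanPlemmons1994, Ch. 6 Thm 2.3 (I27)–(I28)] -/
theorem coercive_of_lapQ (src tgt : Fin m → Fin n) (w : Fin m → ℝ) (hw : ∀ e, 0 ≤ w e)
    (r : Fin n) {c₀ μ : ℝ} (hc₀ : 0 ≤ c₀) (x : Fin n → ℝ) (hx : ∀ i, 0 < x i)
    (hsup : ∀ i, i ≠ r → μ * x i ≤ c₀ * lapQ src tgt w x i) :
    ∀ v : Fin n → ℝ, v r = 0 →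
      μ * ∑ i, v i ^ 2
        ≤ c₀ * (1 / 2 * ∑ i, ∑ j, symmetrize (edgeWeight src tgt w) i j * (v i - v j) ^ 2) := by
  classical
  intro v hv
  set C := symmetrize (edgeWeight src tgt w) with hC
  have hCs : ∀ i j, C i j = C j i := fun i j => symmetrize_symm _ i j
  have hC0 : ∀ i j, i ≠ j → 0 ≤ C i j := fun i j _ => symmetrize_nonneg (edgeWeight_nonneg hw) i j
  set κ : Fin n → ℝ := fun i => if i = r then μ - c₀ * lapQ src tgt w x r / x r else 0 with hκ
  have h := ClassicalModel.coercive_of_supersolution C hCs hC0 (fun _ (_ : Fin 0) => (0 : ℝ)) {r}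
    (μ := μ) hc₀ κ (fun i hi => by simp [hκ, Finset.mem_singleton.not.mp hi]) x hx ?_ v
    (fun i hi => by rw [Finset.mem_singleton.mp hi]; exact hv)
  · simpa using h
  · intro i
    have hL : ∑ j, C i j * (x i - x j) = lapQ src tgt w x i := laplacian_eq_lapQ src tgt w x i
    simp only [Finset.univ_eq_empty, Finset.sum_empty, zero_mul, add_zero, hL]
    by_cases hi : i = r
    · subst hi
      simp only [hκ, if_true]
      have hxr := hx i
      field_simp
      ring_nf
      rfl
    · simp only [hκ, hi, if_false, zero_mul, add_zero]
      exact hsup i hi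

/-! ### A uniform lower bound of Vu–Turitsyn's gap inside a window -/

/-- **Uniform gap bound**: for `|s| ≤ γ ≤ π/2`, `2cos γ − π·sin γ ≤ vtGap s`
(`cos` decreasing and `sin` increasing on `[0, π/2]`, `(π − 2|s|)·sin|s| ≤ π·sin γ`). [folklore] -/
theorem vtGap_ge_uniform {s γ : ℝ} (hγ : γ ≤ π / 2) (hs : |s| ≤ γ) :
    2 * Real.cos γ - π * Real.sin γ ≤ ClassicalModel.LosslessSystem.vtGap s := by
  unfold ClassicalModel.LosslessSystem.vtGap
  have h0 : 0 ≤ |s| := abs_nonneg s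
  have hγ0 : 0 ≤ γ := h0.trans hs
  have hcos : Real.cos γ ≤ Real.cos s := by
    rw [← Real.cos_abs s]
    exact Real.cos_le_cos_of_nonneg_of_le_pi h0 (by linarith [Real.pi_pos]) hs
  have hsin : Real.sin |s| ≤ Real.sin γ :=
    Real.sin_le_sin_of_le_of_le_pi_div_two (by linarith [Real.pi_pos]) hγ hs
  have hsin0 : 0 ≤ Real.sin |s| := Real.sin_nonneg_of_nonneg_of_le_pi h0 (by linarith [Real.pi_pos])
  have hfac : (π - 2 * |s|) * Real.sin |s| ≤ π * Real.sin γ := by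
    have h1 : (π - 2 * |s|) * Real.sin |s| ≤ π * Real.sin |s| := by nlinarith
    have h2 : π * Real.sin |s| ≤ π * Real.sin γ := mul_le_mul_of_nonneg_left hsin Real.pi_pos.le
    linarith
  linarith

/-- The rational level factor of the check bounds the gap: for `0 ≤ τγ` and `|s| ≤ 2·arctan τγ ≤ π/2`,
`2·hcos τγ − 3.141593·hsin τγ ≤ vtGap s`. [folklore] -/
theorem levelFactor_le_vtGap {τγ s : ℝ} (hτ0 : 0 ≤ τγ) (hτ1 : τγ < 1)
    (hs : |s| ≤ 2 * Real.arctan τγ) :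
    2 * hcos τγ - 3141593 / 1000000 * hsin τγ ≤ ClassicalModel.LosslessSystem.vtGap s := by
  have hγ : 2 * Real.arctan τγ ≤ π / 2 := (two_mul_arctan_lt_pi_div_two hτ1).le
  have h := vtGap_ge_uniform hγ hs
  rw [hcos_eq_cos, hsin_eq_sin]
  have hsin0 : 0 ≤ Real.sin (2 * Real.arctan τγ) :=
    Real.sin_nonneg_of_nonneg_of_le_pi (two_mul_arctan_nonneg hτ0) (by linarith [Real.pi_pos])
  have hπ := Real.pi_lt_d6
  nlinarith

/-! ### Rotations of the equilibrium along `1` -/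

/-- The potential energy sees only angle DIFFERENCES of the equilibrium: a common shift `κ` of the
equilibrium leaves it unchanged. [folklore] -/
theorem potential_add_const (p : Params n) (θ δ : Fin n → ℝ) (κ : ℝ) :
    p.potential (fun i => θ i + κ) δ = p.potential θ δ := by
  unfold Params.potential
  simp only [add_sub_add_right_eq_sub]

/-- The energy is unchanged under a common shift of the equilibrium. [folklore] -/
theorem energy_add_const (p : Params n) (θ δ ω : Fin n → ℝ) (κ : ℝ) :
    p.energy (fun i => θ i + κ) δ ω = p.energy θ δ ω := by
  unfold Params.energy
  rw [potential_add_const]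

/-- A common shift of a synchronous equilibrium is a synchronous equilibrium (rotational invariance,
model-2's `pe_add_const`). [folklore] -/
theorem isSyncEquilibrium_add_const (p : Params n) {θ : Fin n → ℝ} (h : p.IsSyncEquilibrium θ)
    (κ : ℝ) : p.IsSyncEquilibrium (fun i => θ i + κ) := by
  intro i
  have := congrFun (p.pe_add_const θ κ) i
  rw [this]
  exact h i

/-- If the injections sum to zero the shifted data ARE the data (`ω₀ = 0`, `P̄ = P⁰`). [folklore] -/
theorem shifted_eq_self_of_sum_P0 (p : Params n) (hP : ∑ i, p.P0 i = 0) : p.shifted = p := by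
  have hω : p.syncFreq = 0 := by unfold Params.syncFreq; rw [hP, zero_div]
  have h : p.Pbar = p.P0 := by
    funext i; rw [Params.Pbar, hω, mul_zero, sub_zero]
  cases p
  simp only [Params.shifted] at h ⊢
  rw [h]

/-! ### The equilibrium of the post-switch model EXISTS -/

/-- **Existence and enclosure of the post-switch synchronous angle vector.** Edge-list data with
pre-switch weights `w0`, post-switch weights `w1`, pre-switch equilibrium tangents `t0`, reference
node `r`, and a certificate `C` passing `C.check`: the post-switch couplings
`b¹ = symmetrize (edgeWeight src tgt w1)` admit `θ¹` with `θ¹_r = θ̃_r` (`θ̃ = halfAngle t1`),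
`|θ¹ᵢ − θ̃ᵢ| < R` at every node, solving ALL `n` power-flow equations
`Σⱼ b¹ᵢⱼ sin(θ¹ᵢ − θ¹ⱼ) = P⁰ᵢ := f⁰ᵢ(halfAngle t0)` (the KEPT injections) exactly, and every post-switch
coupled pair inside `|θ¹ᵢ − θ¹ⱼ| < γ = 2·arctan τγ`. Route: lit-1's
`ClassicalModel.exists_equilibrium_of_residual_reference` with (i) the margin from the window conjuncts,
(ii) coercivity from the supersolution (`coercive_of_lapQ`), (iii) the residual conjunct.
[cite: DvijothamLowChertkov2015, §3.3 Corollary 1; BoydVandenberghe2004, §9.1.2 eq. (9.11)] -/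
theorem exists_equilibrium_of_check {src tgt : Fin m → Fin n} {w0 w1 : Fin m → ℚ}
    {t0 : Fin n → ℚ} {r : Fin n} {C : Cert n m} (hchk : C.check src tgt w0 w1 t0 r) :
    ∃ θ : Fin n → ℝ,
      θ r = halfAngle (fun i => (C.t1 i : ℝ)) r ∧
      (∀ i, |θ i - halfAngle (fun i => (C.t1 i : ℝ)) i| < (C.R : ℝ)) ∧
      (∀ i, ∑ j, symmetrize (edgeWeight src tgt fun e => (w1 e : ℝ)) i j * Real.sin (θ i - θ j)
        = flowQ src tgt (fun e => (w0 e : ℝ)) (fun i => (t0 i : ℝ)) i) ∧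
      (∀ i j, i ≠ j → symmetrize (edgeWeight src tgt fun e => (w1 e : ℝ)) i j ≠ 0 →
        |θ i - θ j| < 2 * Real.arctan (C.τγ : ℝ)) := by
  obtain ⟨⟨hR, hμ, hτ1, hτ1γ, hτγ1, hmar⟩, hedge, hnode, hres, -⟩ := hchk
  set W1 : Fin m → ℝ := fun e => (w1 e : ℝ) with hW1
  set W0 : Fin m → ℝ := fun e => (w0 e : ℝ) with hW0
  set T1 : Fin n → ℝ := fun i => (C.t1 i : ℝ) with hT1
  set T0 : Fin n → ℝ := fun i => (t0 i : ℝ) with hT0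
  set B := symmetrize (edgeWeight src tgt W1) with hB
  have hW1nn : ∀ e, 0 ≤ W1 e := fun e => by simp only [hW1]; exact_mod_cast (hedge e).2.1
  have hBs : ∀ i j, B i j = B j i := fun i j => symmetrize_symm _ i j
  have hB0 : ∀ i j, i ≠ j → 0 ≤ B i j := fun i j _ => symmetrize_nonneg (edgeWeight_nonneg hW1nn) i j
  -- the kept injections sum to zero (losslessness of the PRE-switch network)
  have hP : ∑ i, flowQ src tgt W0 T0 i = 0 := by
    simp_rw [← pe_halfAngle_eq_flowQ]
    exact ClassicalModel.flow_sum_eq_zero _ (fun i j => symmetrize_symm _ i j) _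
  have hτγ0 : (0 : ℝ) ≤ (C.τγ : ℝ) := by exact_mod_cast hτ1.trans hτ1γ
  have hτγ1' : (C.τγ : ℝ) < 1 := by exact_mod_cast hτγ1
  have hγπ : 2 * Real.arctan (C.τγ : ℝ) ≤ π := by
    linarith [two_mul_arctan_lt_pi_div_two hτγ1', Real.pi_pos]
  have hc₀ : hcos (C.τγ : ℝ) ≤ Real.cos (2 * Real.arctan (C.τγ : ℝ)) := (hcos_eq_cos _).le
  have hc₀nn : (0 : ℝ) ≤ hcos (C.τγ : ℝ) := by
    unfold hcos
    apply div_nonneg <;> nlinarith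
  have hRr : (0 : ℝ) < (C.R : ℝ) := by exact_mod_cast hR
  have hμr : (0 : ℝ) < (C.μ : ℝ) := by exact_mod_cast hμ
  -- (i) margin
  have hgap : (C.R : ℝ) ≤ Real.arctan (C.τγ : ℝ) - Real.arctan (C.τ1 : ℝ) := by
    have hu0 : (0 : ℝ) ≤ quot (C.τγ : ℝ) (C.τ1 : ℝ) := by
      unfold quot
      apply div_nonneg
      · exact_mod_cast (show (0 : ℚ) ≤ C.τγ - C.τ1 by linarith)
      · have : (0 : ℝ) ≤ (C.τγ : ℝ) * (C.τ1 : ℝ) := mul_nonneg hτγ0 (by exact_mod_cast hτ1)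
        linarith
    have hmar' : (C.R : ℝ) * (1 + quot (C.τγ : ℝ) (C.τ1 : ℝ) ^ 2) ≤ quot (C.τγ : ℝ) (C.τ1 : ℝ) := by
      have := (Rat.cast_le (K := ℝ)).2 hmar
      rw [Rat.cast_mul, Rat.cast_add, Rat.cast_pow, quot_cast, Rat.cast_one] at this
      exact this
    have h1 := le_arctan_of_mul_le hu0 hmar'
    have h2 : 2 * Real.arctan (C.τγ : ℝ) - 2 * Real.arctan (C.τ1 : ℝ)
        = 2 * Real.arctan (quot (C.τγ : ℝ) (C.τ1 : ℝ)) := by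
      have hprod : (-1 : ℝ) < (C.τγ : ℝ) * (C.τ1 : ℝ) := by
        have : (0 : ℝ) ≤ (C.τγ : ℝ) * (C.τ1 : ℝ) := mul_nonneg hτγ0 (by exact_mod_cast hτ1)
        linarith
      exact two_mul_arctan_sub hprod
    linarith
  have hcoh : ∀ i j, i ≠ j → 0 < B i j → |halfAngle T1 i - halfAngle T1 j| + 2 * (C.R : ℝ)
      ≤ 2 * Real.arctan (C.τγ : ℝ) := by
    intro i j _ hpos
    obtain ⟨e, hwe, hor⟩ := exists_ne_zero_edge src tgt W1 hpos.ne'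
    have hwe' : w1 e ≠ 0 := fun h => hwe (by simp [hW1, h])
    obtain ⟨hp1, hq1, -, -, -, -⟩ := (hedge e).2.2.2.resolve_left hwe'
    have hp1' : (-1 : ℝ) < T1 (src e) * T1 (tgt e) := by simp only [hT1]; exact_mod_cast hp1
    have hq1' : |(T1 (src e) - T1 (tgt e)) / (1 + T1 (src e) * T1 (tgt e))| ≤ (C.τ1 : ℝ) := by
      have := (Rat.cast_le (K := ℝ)).2 hq1
      rw [Rat.cast_abs, quot_cast] at this
      exact this
    have hle : |halfAngle T1 i - halfAngle T1 j| ≤ 2 * Real.arctan (C.τ1 : ℝ) := by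
      rcases hor with ⟨hs, ht⟩ | ⟨hs, ht⟩
      · subst hs; subst ht; exact abs_halfAngle_sub_le hp1' hq1'
      · subst hs; subst ht; rw [abs_sub_comm]; exact abs_halfAngle_sub_le hp1' hq1'
    linarith
  -- (ii) coercivity
  have hsup : ∀ i, i ≠ r → (C.μ : ℝ) * (C.x i : ℝ) ≤ hcos (C.τγ : ℝ) * lapQ src tgt W1 (fun j => (C.x j : ℝ)) i := by
    intro i hi
    have := (Rat.cast_le (K := ℝ)).2 ((hnode i).2 hi)
    rw [Rat.cast_mul, Rat.cast_mul, hcos_cast, lapQ_cast] at this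
    exact this
  have hcoer := coercive_of_lapQ src tgt W1 hW1nn r hc₀nn (fun j => (C.x j : ℝ))
    (fun i => by exact_mod_cast (hnode i).1) hsup
  -- (iii) residual
  have hres' : 4 * ∑ i ∈ univ.erase r,
      (flowQ src tgt W0 T0 i - ∑ j, B i j * Real.sin (halfAngle T1 i - halfAngle T1 j)) ^ 2
      < (C.μ : ℝ) ^ 2 * (C.R : ℝ) ^ 2 := by
    simp_rw [hB, pe_halfAngle_eq_flowQ]
    have := (Rat.cast_lt (K := ℝ)).2 hres
    push_cast at this
    simp_rw [flowQ_cast] at this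
    exact this
  obtain ⟨θ, hr, hball, -, heq, hcoh'⟩ :=
    ClassicalModel.exists_equilibrium_of_residual_reference B (flowQ src tgt W0 T0) hBs hB0 hP r
      (halfAngle T1) hγπ hc₀ hRr hμr hcoh hcoer hres'
  refine ⟨θ, hr, hball, heq, fun i j hij hne => hcoh' i j hij ?_⟩
  exact lt_of_le_of_ne (hB0 i j hij) (Ne.symm hne)

end Summit.Ventures.GridStability.Lyapunov.StructurePreserving.Switch

end
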